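import Summits.ValiantsHypothesis.ValiantsHypothesis.Theorems.KPlusLogSqLawTropicalBSingleGaugeTwoRowsSharp

/-!
# Route «KPlusLogSqLaw», crux `TropicalB` (stmt-ValiantsHypothesis-19771) — DIAMOND(`K−3`) IS SINGLE-GAUGE CERTIFIED AT EVERY SIZE:
# the single-gauge ceiling is at least `(K−3)·m² + 2m` for every `m ≥ 1`, `K ≥ 3`

HONEST FRAMING.  Helper `--supports` the crux `Summit.ValiantsHypothesis.ValiantsHypothesis.Theses.KPlusLogSqLaw.TropicalB` (item
stmt-ValiantsHypothesis-19771, route KPlusLogSqLaw, DRAFT; cell `pub-symmetroid`, seat val-sym-trop-p4 g13, 2026-08-28).  The all-sizes form of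
`TwoRows.exists_singleGauge_chain_twoRows` (`…TropicalBSingleGaugeTwoRowsSharp`): val-sym-trop-p5's DIAMOND design of format `(m, a+3)`,
`m = n + 1`, with its dominant sign-alternating chain of `a·m² + 2m` breakpoints (`…TropicalShiftDiamondChain`), satisfies the hypotheses
`hcert` (one affine row gauge `u_r = −κ·r·θ`, `β = 0`) and `hgen` (pairwise distinct gauged slopes) of THEOREM U / `chain_le_of_universalGauge`
(`ShiftDiamondGauge.hcert`, `ShiftDiamondGauge.hgen`).  So the LOWER side of val-sym-trop-p5's located single-gauge law is kernel at every format: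
**the maximum length of a single-gauge-certified chain of format `(m, K)` is at least `(K−3)·m² + 2m`** (and equals it at `m = 2`, `K ≥ 4`, by
`chain_le_of_universalGauge_twoRows`; THEOREM U bounds it by `(K−2)·m² + m`).  Nothing here bears on `TropicalB` in its window, `WeakLifting`,
the doors, `MatrixDescartes` (stmt-ValiantsHypothesis-18050) or VP ≠ VNP.  [this seat; design and chain: val-sym-trop-p5]
-/

set_option linter.dupNamespace false
set_option autoImplicit false

namespace Summit.ValiantsHypothesis.ValiantsHypothesis.Theorems.KPlusLogSqLaw

open Summit.ValiantsHypothesis.ValiantsHypothesis.Theorems.MatrixDescartes.Negative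
open Summit.ValiantsHypothesis.ValiantsHypothesis.Theorems.LacunarySymmetroidMatrixDescartes.TropicalCensus
open Summit.ValiantsHypothesis.ValiantsHypothesis.Theorems.LacunarySymmetroidMatrixDescartes.TropicalCensus.ShiftDiamond
open scoped BigOperators
open Finset

namespace SingleGauge

/-- **DIAMOND is single-gauge certified at every size.**  For every `a, n` (format `(n+1, a+3)`) there is a design with a dominant
sign-alternating chain of `N = a·(n+1)² + 2(n+1)` breakpoints, distinct consecutive terms, signs in `{−1,0,1}`, and ONE affine row gauge with
pairwise distinct gauged slopes certifying every term column-wise (hypotheses `hgen`, `hcert` of `chain_le_of_universalGauge` verbatim). -/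
theorem exists_singleGauge_chain_diamond (a n : ℕ) :
    ∃ (d : Fin (a + 3) → ℕ) (v ε : Fin (n + 1) → Fin (n + 1) → Fin (a + 3) → ℤ) (α β : Fin (n + 1) → ℚ) (N : ℕ)
      (θ : Fin (N + 1) → ℤ) (p : Fin (N + 1) → Equiv.Perm (Fin (n + 1)) × (Fin (n + 1) → Fin (a + 3))),
      N = a * (n + 1) ^ 2 + 2 * (n + 1) ∧ (∀ i j l, (ε i j l).natAbs ≤ 1) ∧
      (∀ (i i' : Fin (n + 1)) (l l' : Fin (a + 3)), (d l : ℚ) - α i = (d l' : ℚ) - α i' → i = i' ∧ l = l') ∧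
      StrictMono θ ∧ (∀ k, IsDominant d v ε (θ k) (p k)) ∧ (∀ k : Fin N, p k.castSucc ≠ p k.succ) ∧
      (∀ k : Fin N, termSign ε (p k.castSucc) * termSign ε (p k.succ) < 0) ∧
      (∀ (k : Fin (N + 1)) (j i : Fin (n + 1)) (l : Fin (a + 3)), ε i j l ≠ 0 →
        ((θ k : ℚ) * (d l : ℚ) - (v i j l : ℚ)) - (α i * (θ k : ℚ) + β i) ≤
          ((θ k : ℚ) * (d ((p k).2 j) : ℚ) - (v ((p k).1 j) j ((p k).2 j) : ℚ)) - (α ((p k).1 j) * (θ k : ℚ) + β ((p k).1 j))) := by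
  have hsg : ∀ k : Fin (st a n (2 * (n + 1))),
      termSign (ee a n) (cterm a n (grid a n (k.castSucc : ℕ)).1 (grid a n (k.castSucc : ℕ)).2) *
        termSign (ee a n) (cterm a n (grid a n (k.succ : ℕ)).1 (grid a n (k.succ : ℕ)).2) < 0 := by
    intro k
    simp only [Fin.val_castSucc, Fin.val_succ]
    rw [termSign_grid a n k (by omega), termSign_grid a n (k + 1) (by omega), ← pow_add,
      show (k : ℕ) + (k + 1) = 2 * k + 1 by ring, pow_succ, pow_mul]
    norm_num
  refine ⟨dd a n, vv a n, ee a n, fun r => -(kap a n : ℚ) * (r : ℚ), fun _ => 0, st a n (2 * (n + 1)),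
    fun k => th a n (grid a n k).1 (grid a n k).2, fun k => cterm a n (grid a n k).1 (grid a n k).2, ?_, ?_, ?_, ?_, ?_, ?_, hsg, ?_⟩
  · rw [st_top]
  · exact fun r b l => (ee_natAbs a n r b l).le
  · exact ShiftDiamondGauge.hgen a n
  · refine Fin.strictMono_iff_lt_succ.mpr fun k => ?_
    simp only [Fin.val_castSucc, Fin.val_succ]
    exact th_grid_lt a n k (by omega)
  · intro k
    obtain ⟨_, h2, h3⟩ := grid_inv a n k (by omega)
    exact isDominant_cterm a n _ _ h3 h2
  · intro k heq
    have h := hsg k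
    simp only at heq
    rw [heq] at h
    exact absurd h (not_lt.2 (mul_self_nonneg _))
  · intro k j i l _
    obtain ⟨_, h2, h3⟩ := grid_inv a n k (by omega)
    exact ShiftDiamondGauge.hcert a n _ _ h3 h2 j i l

end SingleGauge

end Summit.ValiantsHypothesis.ValiantsHypothesis.Theorems.KPlusLogSqLaw
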